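import Summits.RiemannHypothesis.RiemannHypothesis.Theorems.TiltedLandingLaw421R3Lens1Pinning

/-!
# W-08 ▸ lens-2 ▸ CREDIT NET BOOKS v7 (token-80 candidate after NEG 12; files-only image, registry-neutral)

THESIS (rate side of ⟨33346⟩ at the half purse).  The target `RestRateBotPQ halfPurse` is, level by level, the books
`netCostQ ⊤ (k+1) ≤ slackPQ halfPurse + creditsQ (k+1)` (tree `restRateBotPQ_iff_books_step`, …R3PurseBooks :105), and

  `creditsQ k = min (T₀, injected k)`                                   (§1, K: `creditsQ_eq_min`)

where `injected k` counts the CHARGED levels `j < k` whose lowest's closed 3/2-tent is NON-EMPTY (tree `injected`, …E3Lineage :134, with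
the class `EmptyTrkDQ` = «`tentAt (3/2) f j u < 1` at a lowest u», …R2TrkD :34 / …R3QuadW :34): every charged CROWDED level is REFUNDED one
unit, up to `T₀`.  v6 r2 (NEG 12, (CA874)) discarded exactly these refunds (`creditsQ_nonneg` in its kernel) and priced the horizon against
`slack_½ = … − T₀`; on the comb family the refunds are the whole payer (lens-2 memo CREDIT-READING-v1 053d9e1672adc1d1, §R3–R4: on COMB-λ,
λ = 2…12, every charged level is crowded and `injected = chargeCount ≤ T₀`, so the books read `−cds ≤ slack_½`; the credits-FREE price —
v6's FIT⁗ and equally any «(1 − 4·drop/s)⁺ against slack_½» pricing — goes negative from λ = 8 on: −1.42 / −3.32 / −5.26 at λ = 8 / 10 / 12,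
exact-sign tracker `comb_lambda2.py` 72869377af29de4b, legality of λ ≥ 3 pending crit-1's clause-16 certificate).

THE CUT (an instance of the TREE's class socket `restRateBotPQ_of_threeBooks_ge`, …R3PurseBooks :165, with the coarsest classes and
PROPORTIONAL capital; no energy law, no floor, no lift):
* LAW A `EmptyNetLawQ κ`     := `ClassLawQ EmptyTrkDQ (κ · slackPQ halfPurse)` — the charged EMPTY-tent levels, net of their own signed sinks,
                                 cost at most the share κ of the half slack;
* LAW B `CrowdedCreditLawQ κ` := `CreditLawQ CrowdedQ ((1 − κ) · slackPQ halfPurse)`, `CrowdedQ := diffClass AllLevelsQ EmptyTrkDQ` — the charged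
                                 CROWDED levels, net of their sinks, cost at most the refunds `creditsQ` plus the share 1 − κ;
* (K) the rest class `restClass EmptyTrkDQ AllLevelsQ` is empty, the capital `κS + (1−κ)S + 0 ≤ S` is an identity, INIT is `typedPurse ≤ halfPurse`.
Kernel `restRateBotPQ_half_of_creditNet κ : EmptyNetLawQ κ → CrowdedCreditLawQ κ → RestRateBotPQ halfPurse`; read-back `law421R_of_creditNet`
concludes the crux decl `…Theses.EarlyAppointments.TiltedLandingLaw421R` BY NAME from `TopPinning`, `RegUmbrella11S`, LAW A, LAW B (κ = 1/2 of
record: `law421R_of_creditNet_half`).  §4 (K) `restRateBotPQ_half_iff_sum`: the target is EXACTLY the κ-free SUM of the two laws' left sides —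
so A(κ) ∧ B(κ) is a genuine strengthening-by-split (each law alone is NOT a consequence of the target; each is killable on its own).

RELATION TO THE REGISTRY (v11q, `RhW08.RateSplit.RateLawsHalfCapQ`): same socket, coarser classes (`EmptyTrkDQ = Far ∪ Approach` side versus
`ConsLevelQ = ¬EmptyTrkDQ`, …R3RateBooksQ1b :28), budgets proportional to `slackPQ halfPurse` instead of (energy purse, aR, aC, residual).
Nothing of v11q is touched; this is a sibling rate-side cut, two typed-open stubs instead of four.

PENCIL PRICES at κ = 1/2 (S := slackPQ halfPurse = slack0Q + (B+1)/2; indicative, never lemmas; COMB rows from the exact tracker / crit-1 RT1, SQ1):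
| frame | S | LAW A instance (empty-tent net ≤ S/2) | LAW B instance (crowded net ≤ credits + S/2) |
|---|---|---|---|
| COMB-2 (NEG 12 frame; T₀ 13, 9 charged, all crowded) | 11 (= 6 + 5) | 0 ≤ 5.5 | 9 − cds ≤ 9 + 5.5, i.e. −cds ≤ 5.5 (cds = 6.56 ≥ 0) ✓ margin 12 |
| COMB-4 (SQ1 frame; T₀ 14, 13 charged, crowded (f even ⇒ 0 is a zero of odd-order derivatives; comb teeth interlace)) | 7.72 | 0 ≤ 3.9 | −cds ≤ 3.9 ✓ |
| COMB-8 / 10 / 12 (T₀ 49/61/73; 33/41/49 charged, all crowded, certified) | 47 / 59 / 71 | 0 ≤ S/2 | −cds ≤ S/2 ✓ (target margin +24 / +30 / +36) |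
| HOVER-M, empty tent (M-fold pair hovers M − 1 charged levels, drop 0; B ≥ 2M − 2) | ≥ t² + 3M − 1.5 | M − 1 ≤ S/2 ⟸ 2M − 2 ≤ t² + 3M − 1.5 ✓ always | 0 ≤ … ✓ |
| HOVER-in-crowd (one real zero kept in the tent: T₀ 1, refunds 1; M 20, B ≈ 39) | ≈ 63 | 0 ≤ 31 | M − 2 = 18 ≤ 1 + 31 ✓ |
| RIM-50 (100 rim teeth at ±1.49·h₀ inside the level-0 tent; ≈ 20 slow charged EMPTY-tent levels, net ≈ 13; slack0Q ≈ 1, half 48.5) | ≈ 49.5 | 13 ≤ 24.7 ✓ | 1 − cds ≤ 1 + 24.7 ✓ |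
| S*, F*, X3, TE*, CUT-47d tall columns (tilted frames, B = ⌈R/s⌉ − 1 ≥ 31; ≤ 6 charged levels, cds ≥ −6.6 / −20.5 with half ≥ 16 / 70) | ≥ 40 | ≤ 7 + 6.6 ≤ S/2 ✓ | ✓ |
Braking a lowest to a charged (< s/4) sink needs zero mass above the free density 2/s within the column, which is what B counts; a free-density
gapped comb does not brake below one quarter-step (drop ≈ (a/h) qs ≥ 1.5 qs): the reason the proportional split has room (memo §R5).

HONEST LABEL: LAW A and LAW B are OPEN (typed sockets, account-shaped, no mechanism claimed); §1, §3, §4 are K.  IMAGE CANDIDATE, registry-neutral: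
the skeleton OF RECORD stays `Lines/trkD_v11q.lean` e5f3c2cea72a0413.  ONE TREE import `…R3Lens1Pinning`.  Nothing here bears on the truth of RH;
RH is not proved; 33346/33347 OPEN; checked ≠ landed ≠ proved. -/

namespace RhW08.CreditBooks

open RhW08.Round1 RhW08.StSwap RhW08.Round2 RhW08.QuadW RhW08.SealSwapQ RhW08.PurseP RhIdea6.G17.W07C7 RhIdea6.G17.W07C7.Rev6
open RhW08.SealSwap (PBot)
open RhIdea6.G18.W07C8.Law421BirthS RhIdea6.G19.W07C11.Seam RhIdea6.G20.W07C12.Frac RhIdea6.G20.W07C12.StColP RhW07.C12.FieldSplit RhW07.C14.TwoSided RhW07.C14.Classes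
open RhW07.C14.Booking

/-! ## §1 (K) the credit reading: `creditsQ = min (T₀, injected)` -/

/-- (K) §1 **THE CREDIT READING**: the credits drawn below `k` are `min (T₀, injected k)` — one unit per charged CROWDED level, capped at the level-0 tent count. -/
theorem creditsQ_eq_min (η : ℝ) (f : ℂ → ℂ) (x₀ s hmax R Hs : ℝ) (B k : ℕ) :
    creditsQ η f x₀ s hmax R Hs B k
      = min (tentMeterTrkD (3 / 2) η f x₀ s hmax R Hs B 0) (injected (PTrkSQ PBot) StTrkDQ ReadyR2 EmptyTrkDQ η f x₀ s hmax R Hs B k) := by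
  have hT := tentMeterTrkD_nonneg (3 / 2) η f x₀ s hmax R Hs B 0
  have hi := injected_nonneg (PTrkSQ PBot) StTrkDQ ReadyR2 EmptyTrkDQ η f x₀ s hmax R Hs B k
  unfold creditsQ
  rw [max_eq_left hT]
  rcases le_total (tentMeterTrkD (3 / 2) η f x₀ s hmax R Hs B 0)
      (injected (PTrkSQ PBot) StTrkDQ ReadyR2 EmptyTrkDQ η f x₀ s hmax R Hs B k) with h | h
  · rw [min_eq_left h, max_eq_right (by linarith)]
    ring
  · rw [min_eq_right h, max_eq_left (by linarith)]
    ring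

/-- (K) §1 REFUND regime: while the injections do not exceed `T₀`, every charged crowded level is refunded (`creditsQ = injected`). -/
theorem creditsQ_eq_injected_of_le {η : ℝ} {f : ℂ → ℂ} {x₀ s hmax R Hs : ℝ} {B k : ℕ}
    (h : injected (PTrkSQ PBot) StTrkDQ ReadyR2 EmptyTrkDQ η f x₀ s hmax R Hs B k ≤ tentMeterTrkD (3 / 2) η f x₀ s hmax R Hs B 0) :
    creditsQ η f x₀ s hmax R Hs B k = injected (PTrkSQ PBot) StTrkDQ ReadyR2 EmptyTrkDQ η f x₀ s hmax R Hs B k := by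
  rw [creditsQ_eq_min, min_eq_right h]

/-- (K) §1 CAP regime: once the injections reach `T₀`, the credits are exhausted at `T₀` (`creditsQ = T₀`). -/
theorem creditsQ_eq_tent0_of_le {η : ℝ} {f : ℂ → ℂ} {x₀ s hmax R Hs : ℝ} {B k : ℕ}
    (h : tentMeterTrkD (3 / 2) η f x₀ s hmax R Hs B 0 ≤ injected (PTrkSQ PBot) StTrkDQ ReadyR2 EmptyTrkDQ η f x₀ s hmax R Hs B k) :
    creditsQ η f x₀ s hmax R Hs B k = tentMeterTrkD (3 / 2) η f x₀ s hmax R Hs B 0 := by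
  rw [creditsQ_eq_min, min_eq_left h]

/-! ## §2 (T) the two laws: tent classes, proportional shares of the half slack -/

/-- §2 the SHARE `κ · slackPQ halfPurse` (a `Budget`; tree `scaleBudgetQ`). -/
noncomputable def shareQ (κ : ℝ) : Budget := scaleBudgetQ κ (slackPQ halfPurse)

/-- §2 the CROWDED class: levels whose lowest's closed 3/2-tent is non-empty (`⊤ ∖ EmptyTrkDQ`, the shape the class socket wants). -/
def CrowdedQ : LevelClass := diffClass AllLevelsQ EmptyTrkDQ

/-- ★ (T, OPEN) §2 **LAW A — EMPTY-TENT NET LAW (share κ)**: after every charged level, the charged EMPTY-tent levels so far, net of their own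
signed sinks `4·dropQ/s`, cost at most `κ · slackPQ halfPurse`. -/
def EmptyNetLawQ (κ : ℝ) : Prop := ClassLawQ EmptyTrkDQ (shareQ κ)

/-- ★ (T, OPEN) §2 **LAW B — CROWDED CREDIT LAW (share 1 − κ)**: after every charged level, the charged CROWDED levels so far, net of their
sinks, cost at most the refunds `creditsQ` (one per charged crowded level up to `T₀`, §1) plus `(1 − κ) · slackPQ halfPurse`. -/
def CrowdedCreditLawQ (κ : ℝ) : Prop := CreditLawQ CrowdedQ (shareQ (1 - κ))

/-! ## §3 (K) the kernel on the tree's class socket and the read-back to the crux by name -/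

/-- (K) §3 the rest class `¬Empty ∧ ¬⊤` has no levels: its net cost vanishes. -/
theorem netCostQ_rest_eq_zero (η : ℝ) (f : ℂ → ℂ) (x₀ s hmax R Hs : ℝ) (B k : ℕ) :
    netCostQ (restClass EmptyTrkDQ AllLevelsQ) η f x₀ s hmax R Hs B k = 0 :=
  netCostQ_eq_zero_of_forall_not fun _ _ _ h => h.2 trivial

/-- (K) §3 hence the rest class obeys the zero allowance. -/
theorem classLawQ_rest_zero : ClassLawQ (restClass EmptyTrkDQ AllLevelsQ) (budgetConst 0) := by
  intro η f x₀ s hmax R Hs B _ k _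
  rw [netCostQ_rest_eq_zero]
  exact le_rfl

/-- (K) §3 CAPITAL: the shares `κ`, `1 − κ` and `0` add up to the half slack exactly. -/
theorem capitalLawPQ_shares (κ : ℝ) : CapitalLawPQ halfPurse (shareQ κ) (shareQ (1 - κ)) (budgetConst 0) := by
  intro η f x₀ s hmax R Hs B _
  simp only [shareQ, scaleBudgetQ, budgetConst]
  linarith

/-- ★★ (K) §3 **THE KERNEL**: LAW A(κ) and LAW B(κ) pay `RestRateBotPQ halfPurse` (tree `restRateBotPQ_of_threeBooks_ge` with 𝓕 := EmptyTrkDQ,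
𝓒 := ⊤, INIT from `typedPurse ≤ halfPurse`). -/
theorem restRateBotPQ_half_of_creditNet (κ : ℝ) (hA : EmptyNetLawQ κ) (hB : CrowdedCreditLawQ κ) : RestRateBotPQ halfPurse :=
  restRateBotPQ_of_threeBooks_ge (fun f x₀ s hmax R Hs B _ => typedPurse_le_halfPurse f x₀ s hmax R Hs B)
    hA hB classLawQ_rest_zero (capitalLawPQ_shares κ)

/-- ★★★ (K) §3 **READ-BACK TO THE CRUX BY NAME**: `TopPinning`, `RegUmbrella11S` (SUCC side, landed chain) and LAW A(κ), LAW B(κ) conclude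
`…Theses.EarlyAppointments.TiltedLandingLaw421R`. -/
theorem law421R_of_creditNet (hP : RhW08.Lens1Pinning.TopPinning) (hU : RhW08.Lens1Pinning.RegUmbrella11S)
    (κ : ℝ) (hA : EmptyNetLawQ κ) (hB : CrowdedCreditLawQ κ) :
    Summit.RiemannHypothesis.RiemannHypothesis.Theses.EarlyAppointments.TiltedLandingLaw421R :=
  law421Half_of_succ_rate (RhW08.Lens1Coverage.restSuccBotQ_of_resS
      (RhW08.Lens1Coverage.regRes8S_of_regHungCut10S (RhW08.Lens1Pinning.regHungCut10S_of_topPinning hP hU)))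
    (restRateBotPQ_half_of_creditNet κ hA hB)

/-- (K) §3 the same at the share of record `κ = 1/2`. -/
theorem law421R_of_creditNet_half (hP : RhW08.Lens1Pinning.TopPinning) (hU : RhW08.Lens1Pinning.RegUmbrella11S)
    (hA : EmptyNetLawQ (1 / 2)) (hB : CrowdedCreditLawQ (1 / 2)) :
    Summit.RiemannHypothesis.RiemannHypothesis.Theses.EarlyAppointments.TiltedLandingLaw421R :=
  law421R_of_creditNet hP hU (1 / 2) hA hB

/-! ## §4 (K) honesty: the target is exactly the κ-free SUM of the two laws' left sides -/

/-- (K) §4 the net cost splits over the two tent classes with nothing left over. -/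
theorem netCostQ_all_eq_empty_add_crowded (η : ℝ) (f : ℂ → ℂ) (x₀ s hmax R Hs : ℝ) (B k : ℕ) :
    netCostQ AllLevelsQ η f x₀ s hmax R Hs B k
      = netCostQ EmptyTrkDQ η f x₀ s hmax R Hs B k + netCostQ CrowdedQ η f x₀ s hmax R Hs B k := by
  rw [netCostQ_split EmptyTrkDQ AllLevelsQ, netCostQ_rest_eq_zero, add_zero]
  rfl

/-- ★ (K) §4 **THE TARGET IS THE SUM LAW**: `RestRateBotPQ halfPurse` ⟺ on every legal frame the half slack is non-negative and, after every
charged level, (empty-tent net cost) + (crowded net cost) ≤ `slackPQ halfPurse + creditsQ`.  LAW A(κ) ∧ LAW B(κ) splits this one inequality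
into two with fixed shares — a strengthening, not a restatement. -/
theorem restRateBotPQ_half_iff_sum : RestRateBotPQ halfPurse ↔
    ∀ (η : ℝ) (f : ℂ → ℂ) (x₀ s hmax R Hs : ℝ) (B : ℕ), EngineHyps5 2 η f x₀ s hmax R Hs B →
      0 ≤ slackPQ halfPurse η f x₀ s hmax R Hs B ∧
      ∀ k : ℕ, Charged (PTrkSQ PBot) StTrkDQ ReadyR2 η f x₀ s hmax R Hs B k →
        netCostQ EmptyTrkDQ η f x₀ s hmax R Hs B (k + 1) + netCostQ CrowdedQ η f x₀ s hmax R Hs B (k + 1)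
          ≤ slackPQ halfPurse η f x₀ s hmax R Hs B + creditsQ η f x₀ s hmax R Hs B (k + 1) := by
  rw [restRateBotPQ_iff_books_step]
  refine forall_congr' fun η => forall_congr' fun f => forall_congr' fun x₀ => forall_congr' fun s =>
    forall_congr' fun hmax => forall_congr' fun R => forall_congr' fun Hs => forall_congr' fun B => forall_congr' fun _ => ?_
  refine and_congr Iff.rfl (forall_congr' fun k => forall_congr' fun _ => ?_)
  rw [netCostQ_all_eq_empty_add_crowded]

end RhW08.CreditBooks
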